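import Summits.CriticalPhenomena.SAWScalingLimit.Theorems.SAWLeftRightFKGFKGToTraversalBoundSlitNecklaceFarTip
import HarnessLib

/-!
# Slot law, part 1: the canonical far-tip slot is stable (combinatorics of chart r4 §1, S1)

Crux `SAWLeftRightFKG.FKGToTraversalBound` (stmt-CriticalPhenomena-1878), line `slit-necklace` (reshape r4),
stub `stub_slotLaw : SlotLaw` (lead prover-line-stmt-CriticalPhenomena-1878-c5-0), chart
`Cruxes/FKGToTraversalBound/Lines/slit-necklace-chart-r4.md` §1.

The slot law resamples the MIDDLE `p(τ) … p(τ')` of the `J`-th far-tip piece `(i, j; τ, τ')` of a chord `p`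
(`IsFarTipPiece`, file `…SlitNecklaceFarTip`).  A walk `q` lies in the SLOT of `p` when it has the same prefix
`q(m) = p(m)` (`m ≤ τ`), the same suffix read from some index `τ'' ≥ τ` (`q(τ'' + m) = p(τ' + m)`,
`|q| - τ'' = |p| - τ'`), and stays off the spine on `[τ, τ'']`.  This file is the index bookkeeping of step S1
of the chart, stated over an arbitrary graph and embedding (pure `getVert` arithmetic, no probability):

* `getVert_eq_of_support_eq`, `hasSepWindows_congr` — walks with the same vertex sequence have the same
  `getVert`, hence the same index windows (transport of windows along `Walk.copy` / `Walk.transfer`);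
* `IsFarTipPiece.of_getVert_eq` — a far-tip piece ending at `j` only reads the vertices of index `≤ j`;
* `IsPiece.right_le` — a piece starting before a spine index `i` ends at an index `≤ i`;
* `setOf_earlier_farTipPiece_eq` — hence the far-tip pieces starting before a common spine index `i` of two
  walks agreeing up to `i` are the same;
* `IsFarTipPiece.slot_transfer` — **S1**: a walk in the slot of `p` has the far-tip piece `(i, j + τ'' - τ'; τ, τ'')`;
* `farTipData_unique` — the far-tip piece with exactly `J` far-tip pieces starting before it is unique
  (so the slot is CANONICAL: a function of the chord and `J`);
* `inSlot_self`, `inSlot_congr` — every such chord lies in its own slot, and the slot of a member of the slot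
  is the slot (the slots partition the event).

All statements folklore; no literature fact; axioms are the standard three.
-/

noncomputable section

open MeasureTheory Filter Topology Set Metric
open scoped NNReal ENNReal
open Literature.Probability.LatticeModels
open Literature.Probability.RandomPlanarGeometry
open Literature.Probability.RandomPlanarGeometry.SAW
open Summit.CriticalPhenomena.SAWScalingLimit.Theorems.FKGToTraversalBound.Negative (dom)

namespace Summit.CriticalPhenomena.SAWScalingLimit.Theorems.FKGToTraversalBound.SlitNecklace

section SlotCombinatorics

variable {V : Type*} {G G' : SimpleGraph V} {u v u' v' : V} {E : Type*} [PseudoMetricSpace E]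

/-! ### Windows and pieces only read the vertex sequence -/

/-- Two walks (of possibly different graphs on the same vertex type, with possibly different endpoints)
with the same vertex sequence have the same `getVert`. [folklore] -/
theorem getVert_eq_of_support_eq {p : G.Walk u v} {q : G'.Walk u' v'} (h : p.support = q.support)
    (m : ℕ) : p.getVert m = q.getVert m := by
  have hlen : p.length = q.length := by
    have h' := congrArg List.length h
    rw [SimpleGraph.Walk.length_support, SimpleGraph.Walk.length_support] at h'
    omega
  have key : ∀ k, k ≤ p.length → p.getVert k = q.getVert k := fun k hk => by
    have h1 := p.getVert_eq_support_getElem? hk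
    have h2 := q.getVert_eq_support_getElem? (hlen ▸ hk)
    rw [h, ← h2] at h1
    exact Option.some_injective _ h1
  rcases le_or_gt m p.length with hm | hm
  · exact key m hm
  · calc p.getVert m = v := p.getVert_of_length_le hm.le
      _ = p.getVert p.length := p.getVert_length.symm
      _ = q.getVert p.length := key _ le_rfl
      _ = v' := by rw [hlen]; exact q.getVert_length
      _ = q.getVert m := (q.getVert_of_length_le (hlen ▸ hm.le)).symm

/-- Two walks with the same vertex sequence have the same length. [folklore] -/
theorem length_eq_of_support_eq {p : G.Walk u v} {q : G'.Walk u' v'} (h : p.support = q.support) :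
    p.length = q.length := by
  have h' := congrArg List.length h
  rw [SimpleGraph.Walk.length_support, SimpleGraph.Walk.length_support] at h'
  omega

/-- Index windows only read `getVert`: walks with the same `getVert` have the same strictly separated
index windows. [folklore] -/
theorem hasSepWindows_congr (emb : V → E) {p : G.Walk u v} {q : G'.Walk u' v'}
    (h : ∀ m, p.getVert m = q.getVert m) (k lo hi : ℕ) (y : E) (σ₁ σ₂ : ℝ) :
    HasSepWindows emb p k lo hi y σ₁ σ₂ ↔ HasSepWindows emb q k lo hi y σ₁ σ₂ := by
  unfold HasSepWindows
  simp only [h]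

/-- A far-tip piece ending at the index `j` only reads the vertices of index `≤ j`: it transfers to every
walk of length `≥ j` with the same vertices up to `j`. [folklore] -/
theorem IsFarTipPiece.of_getVert_eq {emb : V → E} {p : G.Walk u v} {q : G'.Walk u' v'} {Sp : Set V}
    {i j τ τ' : ℕ} {ca cb : E} {η : ℝ} (h : IsFarTipPiece emb p Sp i j τ τ' ca cb η)
    (hj : j ≤ q.length) (heq : ∀ m, m ≤ j → q.getVert m = p.getVert m) :
    IsFarTipPiece emb q Sp i j τ τ' ca cb η := by
  obtain ⟨⟨⟨-, hiS⟩, ⟨-, hjS⟩, hij, hint⟩, hiτ, hττ', hτ'j, hfar, hfar', hnear, hnear'⟩ := h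
  refine ⟨⟨⟨by omega, ?_⟩, ⟨hj, ?_⟩, hij, fun n hn hn' => ?_⟩, hiτ, hττ', hτ'j, ?_, ?_,
    fun n hn hn' => ?_, fun n hn hn' => ?_⟩
  · rw [heq i (by omega)]; exact hiS
  · rw [heq j le_rfl]; exact hjS
  · rw [heq n hn'.le]; exact hint n hn hn'
  · rw [heq τ (by omega)]; exact hfar
  · rw [heq τ' hτ'j.le]; exact hfar'
  · rw [heq n (by omega)]; exact hnear n hn hn'
  · rw [heq n hn'.le]; exact hnear' n hn hn'

/-- A piece starting strictly before a spine index `i` ends at an index `≤ i` (no spine index lies strictly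
inside a piece). [folklore] -/
theorem IsPiece.right_le {p : G.Walk u v} {Sp : Set V} {i' j' i : ℕ} (h : IsPiece p Sp i' j')
    (hi : IsSpineIdx p Sp i) (hlt : i' < i) : j' ≤ i := by
  by_contra hji
  exact h.2.2.2 i hlt (not_le.1 hji) hi.2

/-- Two walks agreeing up to a common spine index `i` have the same far-tip pieces starting before `i`.
[folklore] -/
theorem setOf_earlier_farTipPiece_eq {emb : V → E} {p : G.Walk u v} {q : G'.Walk u' v'} {Sp : Set V}
    {i : ℕ} {ca cb : E} {η : ℝ} (hi : IsSpineIdx p Sp i) (hiq : i ≤ q.length)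
    (heq : ∀ m, m ≤ i → q.getVert m = p.getVert m) :
    {i' : ℕ | i' < i ∧ ∃ j' τ₁ τ₁', IsFarTipPiece emb q Sp i' j' τ₁ τ₁' ca cb η} =
      {i' : ℕ | i' < i ∧ ∃ j' τ₁ τ₁', IsFarTipPiece emb p Sp i' j' τ₁ τ₁' ca cb η} := by
  have hi' : IsSpineIdx q Sp i := ⟨hiq, by rw [heq i le_rfl]; exact hi.2⟩
  ext i'
  simp only [Set.mem_setOf_eq]
  refine and_congr_right fun hlt => ⟨?_, ?_⟩
  · rintro ⟨j', τ₁, τ₁', h⟩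
    have hj' : j' ≤ i := h.1.right_le hi' hlt
    exact ⟨j', τ₁, τ₁', h.of_getVert_eq (hj'.trans hi.1) fun m hm => (heq m (hm.trans hj')).symm⟩
  · rintro ⟨j', τ₁, τ₁', h⟩
    have hj' : j' ≤ i := h.1.right_le hi hlt
    exact ⟨j', τ₁, τ₁', h.of_getVert_eq (hj'.trans hiq) fun m hm => heq m (hm.trans hj')⟩

/-! ### S1: the far-tip piece of a walk in the slot -/

/-- **S1 (canonical slot is stable).**  Let `(i, j; τ, τ')` be a far-tip piece of `p`, and let `q` agree
with `p` up to `τ`, carry the suffix `p(τ') …` from the index `τ'' ≥ τ` on (`q(τ'' + m) = p(τ' + m)`,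
`|q| + τ' = |p| + τ''`) and stay off the spine on `[τ, τ'']`.  Then `(i, j + τ'' - τ'; τ, τ'')` is a far-tip
piece of `q`: the near stub `p(i+1) … p(τ-1)`, the far tip `p(τ)`, the far tip `p(τ')` (now at `τ''`) and the
near stub `p(τ'+1) … p(j-1)` are unchanged. [folklore] -/
theorem IsFarTipPiece.slot_transfer {emb : V → E} {p : G.Walk u v} {q : G'.Walk u' v'} {Sp : Set V}
    {i j τ τ' τ'' : ℕ} {ca cb : E} {η : ℝ} (h : IsFarTipPiece emb p Sp i j τ τ' ca cb η)
    (hpre : ∀ m, m ≤ τ → q.getVert m = p.getVert m) (hτ : τ ≤ τ'') (hτ''L : τ'' ≤ q.length)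
    (hlen : q.length + τ' = p.length + τ'') (hsuf : ∀ m, q.getVert (τ'' + m) = p.getVert (τ' + m))
    (hmid : ∀ m, τ ≤ m → m ≤ τ'' → q.getVert m ∉ Sp) :
    IsFarTipPiece emb q Sp i (j + τ'' - τ') τ τ'' ca cb η := by
  obtain ⟨⟨⟨-, hiS⟩, ⟨hjL, hjS⟩, hij, hint⟩, hiτ, hττ', hτ'j, hfar, hfar', hnear, hnear'⟩ := h
  -- index translation for the suffix: for `m ≥ τ''`, `q m = p (m + τ' - τ'')`
  have hsuf' : ∀ m, τ'' ≤ m → q.getVert m = p.getVert (m + τ' - τ'') := fun m hm => by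
    have h' := hsuf (m - τ'')
    rw [Nat.add_sub_cancel' hm] at h'
    rw [h']
    congr 1
    omega
  refine ⟨⟨⟨by omega, ?_⟩, ⟨by omega, ?_⟩, by omega, fun n hn hn' => ?_⟩, hiτ, hτ, by omega, ?_, ?_,
    fun n hn hn' => ?_, fun n hn hn' => ?_⟩
  · rw [hpre i hiτ.le]; exact hiS
  · rw [hsuf' _ (by omega), show j + τ'' - τ' + τ' - τ'' = j by omega]; exact hjS
  · rcases lt_or_ge n τ with hnτ | hnτ
    · rw [hpre n hnτ.le]; exact hint n hn (by omega)
    rcases le_or_gt n τ'' with hnτ'' | hnτ''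
    · exact hmid n hnτ hnτ''
    · rw [hsuf' n hnτ''.le]; exact hint _ (by omega) (by omega)
  · rw [hpre τ le_rfl]; exact hfar
  · rw [hsuf' τ'' le_rfl, show τ'' + τ' - τ'' = τ' by omega]; exact hfar'
  · rw [hpre n hn'.le]; exact hnear n hn hn'
  · rw [hsuf' n hn.le]; exact hnear' _ (by omega) (by omega)

/-- **The far-tip piece with exactly `J` far-tip pieces starting before it is unique**: two far-tip pieces
with the same number of far-tip pieces starting before them start at the same spine index (the counting
sets are nested and the smaller start index belongs to the larger one), hence end at the same spine index
(the next one), hence have the same tips (`IsFarTipPiece.tips_unique`). [folklore] -/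
theorem farTipData_unique {emb : V → E} {p : G.Walk u v} {Sp : Set V} {ca cb : E} {η : ℝ} {J : ℕ}
    {i₁ j₁ τ₁ τ₁' i₂ j₂ τ₂ τ₂' : ℕ}
    (h₁ : IsFarTipPiece emb p Sp i₁ j₁ τ₁ τ₁' ca cb η)
    (hJ₁ : {i' : ℕ | i' < i₁ ∧ ∃ j' t t', IsFarTipPiece emb p Sp i' j' t t' ca cb η}.ncard = J)
    (h₂ : IsFarTipPiece emb p Sp i₂ j₂ τ₂ τ₂' ca cb η)
    (hJ₂ : {i' : ℕ | i' < i₂ ∧ ∃ j' t t', IsFarTipPiece emb p Sp i' j' t t' ca cb η}.ncard = J) :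
    i₁ = i₂ ∧ j₁ = j₂ ∧ τ₁ = τ₂ ∧ τ₁' = τ₂' := by
  have key : ∀ {i₁ j₁ τ₁ τ₁' i₂ : ℕ}, IsFarTipPiece emb p Sp i₁ j₁ τ₁ τ₁' ca cb η → i₁ < i₂ →
      {i' : ℕ | i' < i₁ ∧ ∃ j' t t', IsFarTipPiece emb p Sp i' j' t t' ca cb η}.ncard <
        {i' : ℕ | i' < i₂ ∧ ∃ j' t t', IsFarTipPiece emb p Sp i' j' t t' ca cb η}.ncard := by
    intro i₁ j₁ τ₁ τ₁' i₂ h₁ hlt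
    apply Set.ncard_lt_ncard
    · refine ⟨fun i' hi' => ⟨hi'.1.trans hlt, hi'.2⟩, fun hsub => ?_⟩
      have hmem : i₁ ∈ {i' : ℕ | i' < i₂ ∧ ∃ j' t t', IsFarTipPiece emb p Sp i' j' t t' ca cb η} :=
        ⟨hlt, j₁, τ₁, τ₁', h₁⟩
      exact lt_irrefl i₁ (hsub hmem).1
    · exact (Set.finite_Iio i₂).subset fun i' hi' => hi'.1
  have hi : i₁ = i₂ := by
    by_contra hne
    rcases lt_or_gt_of_ne hne with hlt | hlt
    · have h' := key h₁ hlt; omega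
    · have h' := key h₂ hlt; omega
  subst hi
  have hj : j₁ = j₂ := by
    by_contra hne
    rcases lt_or_gt_of_ne hne with hlt | hlt
    · exact h₂.1.2.2.2 j₁ (by have h' := h₁.1.2.2.1; omega) hlt h₁.1.2.1.2
    · exact h₁.1.2.2.2 j₂ (by have h' := h₂.1.2.2.1; omega) hlt h₂.1.2.1.2
  subst hj
  exact ⟨rfl, rfl, h₁.tips_unique h₂⟩

/-! ### The slots partition the event -/

/-- A chord with a far-tip piece `(i, j; τ, τ')` lies in its own slot (with `τ'' := τ'`). [folklore] -/
theorem IsFarTipPiece.inSlot_self {emb : V → E} {p : G.Walk u v} {Sp : Set V} {i j τ τ' : ℕ}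
    {ca cb : E} {η : ℝ} (h : IsFarTipPiece emb p Sp i j τ τ' ca cb η) :
    (∀ m, m ≤ τ → p.getVert m = p.getVert m) ∧
      ∃ τ'', τ ≤ τ'' ∧ τ'' ≤ p.length ∧ p.length + τ' = p.length + τ'' ∧
        (∀ m, p.getVert (τ'' + m) = p.getVert (τ' + m)) ∧ ∀ m, τ ≤ m → m ≤ τ'' → p.getVert m ∉ Sp :=
  ⟨fun _ _ => rfl, τ', h.2.2.1, h.2.2.2.1.le.trans h.1.2.1.1, rfl, fun _ => rfl,
    fun m hm hm' => h.1.2.2.2 m (by have h' := h.2.1; omega) (by have h' := h.2.2.2.1; omega)⟩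

/-- The slot of a member `q` of the slot of `p` (read from its own suffix index `τ''`) is the slot of `p`.
[folklore] -/
theorem inSlot_congr {w w' : V} {p : G.Walk u v} {q : G.Walk u' v'} {r : G.Walk w w'} {Sp : Set V}
    {τ τ' τ'' : ℕ} (hpre : ∀ m, m ≤ τ → q.getVert m = p.getVert m)
    (hlen : q.length + τ' = p.length + τ'') (hsuf : ∀ m, q.getVert (τ'' + m) = p.getVert (τ' + m)) :
    ((∀ m, m ≤ τ → r.getVert m = q.getVert m) ∧
        ∃ σ, τ ≤ σ ∧ σ ≤ r.length ∧ r.length + τ'' = q.length + σ ∧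
          (∀ m, r.getVert (σ + m) = q.getVert (τ'' + m)) ∧ ∀ m, τ ≤ m → m ≤ σ → r.getVert m ∉ Sp) ↔
      ((∀ m, m ≤ τ → r.getVert m = p.getVert m) ∧
        ∃ σ, τ ≤ σ ∧ σ ≤ r.length ∧ r.length + τ' = p.length + σ ∧
          (∀ m, r.getVert (σ + m) = p.getVert (τ' + m)) ∧ ∀ m, τ ≤ m → m ≤ σ → r.getVert m ∉ Sp) := by
  constructor
  · rintro ⟨hpre', σ, h₁, h₂, h₃, h₄, h₅⟩
    exact ⟨fun m hm => (hpre' m hm).trans (hpre m hm), σ, h₁, h₂, by omega,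
      fun m => (h₄ m).trans (hsuf m), h₅⟩
  · rintro ⟨hpre', σ, h₁, h₂, h₃, h₄, h₅⟩
    exact ⟨fun m hm => (hpre' m hm).trans (hpre m hm).symm, σ, h₁, h₂, by omega,
      fun m => (h₄ m).trans (hsuf m).symm, h₅⟩

/-- **Registered form of S1** (crux stmt-CriticalPhenomena-1878, line `slit-necklace`, helper of `stub_slotLaw`): a
walk `q` in the slot of `p` (same prefix up to `τ`, same suffix from `τ''`, off the spine on `[τ, τ'']`) has the
far-tip piece `(i, j + τ'' - τ'; τ, τ'')` and the same number of far-tip pieces starting before `i`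
(`IsFarTipPiece.slot_transfer`, `setOf_earlier_farTipPiece_eq`). [folklore] -/
theorem farTipPiece_slot_transfer :
    ∀ {V E : Type*} [PseudoMetricSpace E] {G G' : SimpleGraph V} {u v u' v' : V} (emb : V → E)
      (p : G.Walk u v) (q : G'.Walk u' v') (Sp : Set V) (i j τ τ' τ'' : ℕ) (ca cb : E) (η : ℝ),
      IsFarTipPiece emb p Sp i j τ τ' ca cb η → (∀ m, m ≤ τ → q.getVert m = p.getVert m) → τ ≤ τ'' →
      τ'' ≤ q.length → q.length + τ' = p.length + τ'' → (∀ m, q.getVert (τ'' + m) = p.getVert (τ' + m)) →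
      (∀ m, τ ≤ m → m ≤ τ'' → q.getVert m ∉ Sp) →
      IsFarTipPiece emb q Sp i (j + τ'' - τ') τ τ'' ca cb η ∧
        {i' : ℕ | i' < i ∧ ∃ j' τ₁ τ₁', IsFarTipPiece emb q Sp i' j' τ₁ τ₁' ca cb η}.ncard =
          {i' : ℕ | i' < i ∧ ∃ j' τ₁ τ₁', IsFarTipPiece emb p Sp i' j' τ₁ τ₁' ca cb η}.ncard :=
  fun _ _ _ _ _ _ _ _ _ _ _ _ h hpre hτ hτ''L hlen hsuf hmid =>
    ⟨h.slot_transfer hpre hτ hτ''L hlen hsuf hmid,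
      congrArg Set.ncard (setOf_earlier_farTipPiece_eq h.1.1 (by have h' := h.2.1; omega)
        fun m hm => hpre m (by have h' := h.2.1; omega))⟩

end SlotCombinatorics

end Summit.CriticalPhenomena.SAWScalingLimit.Theorems.FKGToTraversalBound.SlitNecklace

end
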